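import Mathlib

/-!
# Rank subadditivity over the residue classes of the row set (stub `stub_rankSplit`)

The stub `stub_rankSplit` of the crux `MobiusLadder.QuadraticDigitPhases`
(stmt-QuantumAdvantage-1391), line `Sketch`.

For a polynomial `P` over `𝔽₂` in the bit variables `x₀, …, x_{n-1}`, a row set `B ⊆ ℕ`, a column
bound `N` and a separation `s`, the far coefficient matrix `M_B` has entry `(i, j)` equal to the
coefficient of `Xᵢ Xⱼ` in `P` when `i ∈ B`, `j < N` and `dist i j > s`, and `0` otherwise.  For
`m > 0` every row index `i ∈ B` lies in exactly one residue class `B ∩ (c mod m)` with `c < m`, so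
`M_B = Σ_{c < m} M_{B ∩ (c mod m)}` entrywise, and the subadditivity of the rank of matrices over a
field gives `rank M_B ≤ Σ_{c < m} rank M_{B ∩ (c mod m)}`.  Elementary (folklore); the subadditivity
lemma `rank_sum_le` is proved locally since Mathlib has no `Matrix.rank_add_le` (cf. the local copies
in `Literature/Computability/AlgebraicComplexity/MignonRessayreBound.lean`).
-/

set_option linter.dupNamespace false -- D-0017: single-problem summit ⇒ QuantumAdvantage.QuantumAdvantage by design

namespace Summit.QuantumAdvantage.QuantumAdvantage.Theorems.MobiusLadderQuadraticDigitPhasesStubRankSplit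

open Finset

/-- Subadditivity of the rank over a finite sum of matrices over a field:
`rank (Σ_{c ∈ S} A c) ≤ Σ_{c ∈ S} rank (A c)` (the range of `A + A'` lies in the sum of the ranges,
then induction on `S`). -/
theorem rank_sum_le {K : Type*} [Field K] {m n ι : Type*} [Fintype n] (S : Finset ι)
    (A : ι → Matrix m n K) : (∑ c ∈ S, A c).rank ≤ ∑ c ∈ S, (A c).rank := by
  -- adapted from Literature/Barriers/ValiantsHypothesis/FullRankMultilinearRank.lean
  -- (rank_add_le', rank_sum_le')
  classical
  have hadd : ∀ A A' : Matrix m n K, (A + A').rank ≤ A.rank + A'.rank := by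
    intro A A'
    unfold Matrix.rank
    rw [Matrix.mulVecLin_add]
    exact (Submodule.finrank_mono (LinearMap.range_add_le _ _)).trans
      (Submodule.finrank_add_le_finrank_add_finrank _ _)
  induction S using Finset.induction_on with
  | empty => simp
  | insert a S ha ih =>
    rw [Finset.sum_insert ha, Finset.sum_insert ha]
    exact (hadd _ _).trans (Nat.add_le_add_left ih _)

/-- A guarded sum over the residues `c < m` collapses to the single residue `a % m` (`0 < m`):
`Σ_{c < m} (if (p ∧ a % m = c) ∧ q then x else 0) = if p ∧ q then x else 0`. -/
theorem sum_range_ite_mod_eq {α : Type*} [AddCommMonoid α] (a m : ℕ) (hm : 0 < m) (p q : Prop)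
    [Decidable p] [Decidable q] (x : α) :
    (∑ c ∈ Finset.range m, if (p ∧ a % m = c) ∧ q then x else 0) = if p ∧ q then x else 0 := by
  rw [Finset.sum_eq_single (a % m)]
  · congr 1
    exact propext ⟨fun h => ⟨h.1.1, h.2⟩, fun h => ⟨⟨h.1, rfl⟩, h.2⟩⟩
  · intro c _ hc
    rw [if_neg]
    rintro ⟨⟨_, h⟩, _⟩
    exact hc h.symm
  · intro h
    exact absurd (Finset.mem_range.2 (Nat.mod_lt a hm)) h

/-- STUB `stub_rankSplit`: the rank of the far coefficient matrix with row set `B` is at most the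
sum over the residues `c < m` (`0 < m`) of the ranks of the far coefficient matrices with row sets
`B ∩ (c mod m)`: the former matrix is the sum of the latter, and the rank is subadditive. -/
theorem stub_rankSplit :
    ∀ (n : ℕ) (P : MvPolynomial (Fin n) (ZMod 2)) (s : ℕ) (B : Finset ℕ) (N m : ℕ), 0 < m →
      (Matrix.of fun (i j : Fin n) => if (i : ℕ) ∈ B ∧ (j : ℕ) < N ∧ s < Nat.dist (i : ℕ) (j : ℕ) then MvPolynomial.coeff (Finsupp.single i 1 + Finsupp.single j 1) P else 0).rank ≤
        ∑ c ∈ Finset.range m, (Matrix.of fun (i j : Fin n) => if (i : ℕ) ∈ (B.filter (fun b => b % m = c)) ∧ (j : ℕ) < N ∧ s < Nat.dist (i : ℕ) (j : ℕ) then MvPolynomial.coeff (Finsupp.single i 1 + Finsupp.single j 1) P else 0).rank := by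
  intro n P s B N m hm
  refine le_trans (le_of_eq (congrArg Matrix.rank ?_)) (rank_sum_le (Finset.range m) fun c =>
    Matrix.of fun (i j : Fin n) => if (i : ℕ) ∈ (B.filter (fun b => b % m = c)) ∧ (j : ℕ) < N ∧
      s < Nat.dist (i : ℕ) (j : ℕ) then MvPolynomial.coeff (Finsupp.single i 1 + Finsupp.single j 1) P
      else 0)
  ext i j
  rw [Matrix.sum_apply]
  simp only [Matrix.of_apply, Finset.mem_filter]
  exact (sum_range_ite_mod_eq (i : ℕ) m hm _ _ _).symm

end Summit.QuantumAdvantage.QuantumAdvantage.Theorems.MobiusLadderQuadraticDigitPhasesStubRankSplit
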